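import Summits.Ventures.PercRepro.RankLevelSetExplicitLin2KeyL

/-!
# PercRepro — THE LEVEL-15 THEOREM-M ROW OF C-025 (SHARP): THE KEY AT `p = 33 419`, PART A: chunks 1 … 8 of 16 (p4, S4 feed)

`proofs/P4-gen18.md`. The THEOREM-M key `KeyL 15 33419 d` (RankLevelSetExplicitLin2KeyL) at the coranks of the level-15 row
`16 … 16399`, by the kernel (`decide`, 8 chunks of 2 048); the row is assembled in
RankLevelSetExplicitLin2IndepRowSFifteen. Axioms: standard.
-/

namespace PercRepro

namespace ThmN

namespace Explicit

/-- The THEOREM-M key row at `(q, p) = (15, 33 419)`, chunk 1 of 16: coranks `16 … 2063`, by the kernel. -/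
theorem key_fifteen_indepS_row_1 : ∀ t < 2048, KeyL 15 33419 (16 + t) := by decide +kernel

/-- The THEOREM-M key row at `(q, p) = (15, 33 419)`, chunk 2 of 16: coranks `2064 … 4111`, by the kernel. -/
theorem key_fifteen_indepS_row_2 : ∀ t < 2048, KeyL 15 33419 (16 + (2048 + t)) := by decide +kernel

/-- The THEOREM-M key row at `(q, p) = (15, 33 419)`, chunk 3 of 16: coranks `4112 … 6159`, by the kernel. -/
theorem key_fifteen_indepS_row_3 : ∀ t < 2048, KeyL 15 33419 (16 + (4096 + t)) := by decide +kernel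

/-- The THEOREM-M key row at `(q, p) = (15, 33 419)`, chunk 4 of 16: coranks `6160 … 8207`, by the kernel. -/
theorem key_fifteen_indepS_row_4 : ∀ t < 2048, KeyL 15 33419 (16 + (6144 + t)) := by decide +kernel

/-- The THEOREM-M key row at `(q, p) = (15, 33 419)`, chunk 5 of 16: coranks `8208 … 10255`, by the kernel. -/
theorem key_fifteen_indepS_row_5 : ∀ t < 2048, KeyL 15 33419 (16 + (8192 + t)) := by decide +kernel

/-- The THEOREM-M key row at `(q, p) = (15, 33 419)`, chunk 6 of 16: coranks `10256 … 12303`, by the kernel. -/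
theorem key_fifteen_indepS_row_6 : ∀ t < 2048, KeyL 15 33419 (16 + (10240 + t)) := by decide +kernel

/-- The THEOREM-M key row at `(q, p) = (15, 33 419)`, chunk 7 of 16: coranks `12304 … 14351`, by the kernel. -/
theorem key_fifteen_indepS_row_7 : ∀ t < 2048, KeyL 15 33419 (16 + (12288 + t)) := by decide +kernel

/-- The THEOREM-M key row at `(q, p) = (15, 33 419)`, chunk 8 of 16: coranks `14352 … 16399`, by the kernel. -/
theorem key_fifteen_indepS_row_8 : ∀ t < 2048, KeyL 15 33419 (16 + (14336 + t)) := by decide +kernel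

end Explicit

end ThmN

end PercRepro
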